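import Summits.QuantumFields.YangMills.Theorems.UnitScaleTiltProp7SectET3DeltaPiT3
import HarnessLib

/-!
# Route `UnitScaleTilt`, crux «MinimiserStabilityRegPr» (stmt-QuantumFields-19200, stub EX) ∕ (O″χ) B0 (stmt-QuantumFields-20520), node N06(d = 3), route (α) —
# DEFINITIONS FILE, LAYER 0 BRICK L0b PART 3: **PRINT'S `Δ₁` OF (3.127)–(3.128) AT A T³ MEMBER AS A TOTAL LETTER WITH THE J-TERM AS A SLOT, `Δ₁ := Pᵀ(Δ^η + T_J)P`, AND — BY NAME —
# `G₁ = (Δ₁ + DRD* + aQ*Q)⁻¹` (3.128)∕(110), `H₁ = G₁Q*(QG₁Q*)⁻¹` (3.129), `𝔊 = G₁𝔓*` (3.147) AND THEIR READERS IN THE EX BINDER TYPES** (the instances `Δx := DeltaOne T_J` of brick L0d's total letters)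

Cell `ym-inputs` (desk `pub/ym-inputs`, INPUT-LIST.md v6 §4 row p01 = I-06 B0 DEFINER LEAD, layer 0 = the (L2)∕(L4)∕(L6) DEFINITION programme of WANTED №g25-1; memo
`pub/ym-inputs/DEFINER-MEMO-T3.md` §2 L0b∕L0d; seat `ym-inputs-p01`).  DEFINITIONS + `rfl`-glue only (0 `sorry`); `--supports stmt-QuantumFields-20520 --as helper`; count-neutral.
YM₃ on T³ is ladder rung R3, NOT the Clay problem; nothing here is a claim about a stub, a crux, d = 4 or the mass gap.

THE PRINT ([Balaban1985BackgroundPropagators] p.421).  «a linearizing transformation creates new quadratic terms in an expansion of the action … connected with the linear term in the expansion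
(3.12), so they are small because the configuration J is small … (3.127) … by G₁ the operator defined by the quadratic form ⟨A − DG′RD*A, Δ(A − DG′RD*A)⟩ − 2⟨HC⁽²⁾(A − DG′RD*A), J⟩ + ‖RD*A‖² +
a‖QA‖² (3.128).  Then we have the formula H₁B = G₁Q*(QG₁Q*)⁻¹B (3.129).»  So `G₁⁻¹ = Pᵀ(Δ + T_J)P + DRD* + Q*aQ` with `P = 1 − DG′RD*` ((3.119), brick L0b part 2's `gaugeCorr`) and `T_J` THE OPERATOR OF
THE QUADRATIC FORM `A ↦ −2⟨HC⁽²⁾(A), J⟩` (`C⁽²⁾` = second-order term of the non-linear averaging, `J` = the current of (3.12); the tree's dictionary-level `B12ActionExpansion26Lattice.delta1Form`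
carries the same two data).  THIS FILE keeps `T_J` as a SLOT `TJ : U₀ ↦ (L²(bonds) →ₗ L²(bonds))` — the T³ `C⁽²⁾` of the symmetric averaging is not in the tree yet (layer 1) — and records that
`T_J := 0` gives back `Δ_π` (`DeltaOne_zero`): print's `G = G₀`-vs-`G₁` distinction is exactly the slot.  Every identity row of the EX display holds for these letters for ANY `T_J` (sibling
`…DeltaOneT3Rows`), because `Δ₁` is again a `Pᵀ(·)P` sandwich and `P(D_{U₀}λ) = 0` on `N_S(U₀)`.

WHAT IS DEFINED (member `F`, `h : n ≤ K`, weights `c₀, cB`, `a`, slot `TJ`, background `U₀`): `DeltaOne … TJ : U₀ ↦ Pᵀ(Δ^η_{U₀} + T_J(U₀))P` (the `Δx`-slot letter); BY NAME the instances of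
brick L0d: `G1pi` (`G₁`, (3.128)), `Kinv1pi` (`(QG₁Q*)⁻¹`), `H1pi` (`H₁`, (3.129), Hilbert level), `frakG1pi` (`𝔊 = G₁𝔓*`, (3.147)), and the READERS OF RECORD in the EX binder types
`H1fOne` (`H₁f`, (115)-valued), `frakGfOne` (`𝒢f`), `HfOne` (the `h46tw`-type reader `η • toL2⁻¹ ∘ H₁ ∘ toL2B`).  Glue: `DeltaOne_apply`, `inner_DeltaOne` ((3.128) as a form), `DeltaOne_zero`
(`T_J = 0` ⇒ `Δ₁ = Δ_π`, so `G1pi … 0 = Gpi`, `H1pi … 0 = Hpi`).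
HONEST SCOPE.  Definitions; positivity (`PosOnto … (DeltaOne TJ) U₀`, [B9] Thm 3.11 for `G₁`) and the smallness of `T_J` ((3.131)–(3.133)) are N06 inputs, displayed not proved; `T_J` itself
(the T³ `C⁽²⁾` and `J`) is layer 1.  Nothing of print asserted.

References: T. Bałaban, CMP **99** (1985) 389–434 [Balaban1985BackgroundPropagators] ((3.119) p.419, (3.122)–(3.126) p.420, (3.127)–(3.130) p.421, (3.147) p.425); CMP **102** (1985) 277–309
[Balaban1985Variational] ((45) p.285, (103) p.293, (110)–(111) p.294, (115)–(117) pp.294–295); CMP **109** (1987) 249–301 [Balaban1987RG1] ((2.7)–(2.8) p.266).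
-/

set_option autoImplicit false

noncomputable section

open scoped InnerProductSpace ComplexConjugate Matrix.Norms.L2Operator BigOperators

namespace Summit.QuantumFields.YangMills.Theorems.Prop7SectET3DeltaOne

open Literature.MathematicalPhysics.QuantumFieldTheory.Balaban1983to89
open Literature.MathematicalPhysics.QuantumFieldTheory.Balaban1983to89.T3ContinuumYM3Torus
open T3SectALandauChart (eta)
open B9SectCLatticeCarrier (Bond)
open B9Eq311L2Pairing (WL2)
open B11Eq115Space (NegSize Space115 JetSup NegSup)
open B11Eq111FrakG (nabla115)
open B11Eq103H1Complex (SiteL2K BondL2K)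
open Summit.QuantumFields.YangMills.Theorems.Prop7SectET3Transport (periodsT3 bondEquiv bgOfCfg)
open Summit.QuantumFields.YangMills.Theorems.Prop7SectET3HilbertLetters (W₂ toL2 toL2B DL2 DstarL2)
open Summit.QuantumFields.YangMills.Theorems.Prop7SectET3GaugeProjector (RS)
open Summit.QuantumFields.YangMills.Theorems.Prop7SectET3CurvedPropagators (PosOnto GT KinvT HT Hf H1f frakGT frakGfR)
open Summit.QuantumFields.YangMills.Theorems.Prop7SectET3WilsonHessian (DeltaEta)
open Summit.QuantumFields.YangMills.Theorems.Prop7SectET3DeltaPi (gaugeCorr DeltaPi DeltaPiSlot)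

variable (F : T3Family) (n K : ℕ) (h : n ≤ K) (c₀ cB a : ℝ) [Fact (0 < c₀)] [Fact (0 < cB)]
variable (TJ : GaugeField (F.P K) 0 (Matrix.specialUnitaryGroup (Fin 2) ℂ) → (BondL2K ℂ 3 (periodsT3 F K) c₀ W₂ →ₗ[ℂ] BondL2K ℂ 3 (periodsT3 F K) c₀ W₂))

/-! ## §1 `Δ₁ = Pᵀ(Δ^η + T_J)P` as a slot letter -/

/-- **PRINT'S `Δ₁(U₀)` OF (3.127)–(3.128) WITH THE J-TERM AS A SLOT: `U₀ ↦ Pᵀ(Δ^η_{U₀} + T_J(U₀))P`, `P = 1 − DG′R_SD*`** — the operator of the quadratic form `⟨PA, Δ(PA)⟩ − 2⟨HC⁽²⁾(PA), J⟩` once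
`T_J` is the operator of `A ↦ −2⟨HC⁽²⁾(A), J⟩`; in the `Δx`-slot type of brick L0d. [cite: Balaban1985BackgroundPropagators, (3.127)–(3.128) p.421, (3.119) p.419] -/
def DeltaOne : GaugeField (F.P K) 0 (Matrix.specialUnitaryGroup (Fin 2) ℂ) → (BondL2K ℂ 3 (periodsT3 F K) c₀ W₂ →ₗ[ℂ] BondL2K ℂ 3 (periodsT3 F K) c₀ W₂) :=
  fun U₀ => LinearMap.adjoint (gaugeCorr F n K h c₀ cB a U₀) ∘ₗ
    ((DeltaEta F n K c₀ U₀ : BondL2K ℂ 3 (periodsT3 F K) c₀ W₂ →ₗ[ℂ] BondL2K ℂ 3 (periodsT3 F K) c₀ W₂) + TJ U₀) ∘ₗ gaugeCorr F n K h c₀ cB a U₀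

/-! ## §2 Print's `G₁`, `(QG₁Q*)⁻¹`, `H₁`, `𝔊` BY NAME, and the readers of record in the EX binder types -/

/-- **PRINT'S `G₁(U₀) = (Δ₁ + DRD* + aQ*Q)⁻¹` (3.128)∕(110) AT THE MEMBER** (total: brick L0d's `GT` at `Δx := DeltaOne TJ`). [cite: Balaban1985BackgroundPropagators, (3.128) p.421; Balaban1985Variational, (110) p.294] -/
abbrev G1pi (U₀ : GaugeField (F.P K) 0 (Matrix.specialUnitaryGroup (Fin 2) ℂ)) : BondL2K ℂ 3 (periodsT3 F K) c₀ W₂ →ₗ[ℂ] BondL2K ℂ 3 (periodsT3 F K) c₀ W₂ :=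
  GT F n K h c₀ cB a (DeltaOne F n K h c₀ cB a TJ) U₀

/-- **`(QG₁Q*)⁻¹` AT THE MEMBER** (total: brick L0d's `KinvT` at `Δx := DeltaOne TJ`). [cite: Balaban1985BackgroundPropagators, (3.129) p.421] -/
abbrev Kinv1pi (U₀ : GaugeField (F.P K) 0 (Matrix.specialUnitaryGroup (Fin 2) ℂ)) : WL2 ℂ (fun _ : PBond (F.P n) 0 => cB) W₂ →ₗ[ℂ] WL2 ℂ (fun _ : PBond (F.P n) 0 => cB) W₂ :=
  KinvT F n K h c₀ cB a (DeltaOne F n K h c₀ cB a TJ) U₀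

/-- **PRINT'S `H₁(U₀) = G₁Q*(QG₁Q*)⁻¹` (3.129) AT THE MEMBER, Hilbert level** (total: brick L0d's `HT` at `Δx := DeltaOne TJ`). [cite: Balaban1985BackgroundPropagators, (3.129) p.421; Balaban1985Variational, (103) p.293] -/
abbrev H1pi (U₀ : GaugeField (F.P K) 0 (Matrix.specialUnitaryGroup (Fin 2) ℂ)) : WL2 ℂ (fun _ : PBond (F.P n) 0 => cB) W₂ →ₗ[ℂ] BondL2K ℂ 3 (periodsT3 F K) c₀ W₂ :=
  HT F n K h c₀ cB a (DeltaOne F n K h c₀ cB a TJ) U₀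

/-- **PRINT'S `𝔊(U₀) = G₁𝔓*` (3.147) AT THE MEMBER, Hilbert level** (total: brick L0d's `frakGT` at `Δx := DeltaOne TJ`). [cite: Balaban1985BackgroundPropagators, (3.147) p.425; Balaban1985Variational, (111) p.294] -/
abbrev frakG1pi (U₀ : GaugeField (F.P K) 0 (Matrix.specialUnitaryGroup (Fin 2) ℂ)) : BondL2K ℂ 3 (periodsT3 F K) c₀ W₂ →ₗ[ℂ] BondL2K ℂ 3 (periodsT3 F K) c₀ W₂ :=
  frakGT F n K h c₀ cB a (DeltaOne F n K h c₀ cB a TJ) U₀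

/-- **THE `h46tw`-TYPE READER OF `H₁` ON THE ROUTE CARRIERS** (`η • toL2⁻¹ ∘ H₁ ∘ toL2B`, brick L0d's `Hf` at `Δx := DeltaOne TJ`). [cite: Balaban1985Variational, (45)–(46) p.285; Balaban1985BackgroundPropagators, (3.129) p.421] -/
abbrev HfOne (U₀ : GaugeField (F.P K) 0 (Matrix.specialUnitaryGroup (Fin 2) ℂ)) : (PBond (F.P n) 0 → Matrix (Fin 2) (Fin 2) ℂ) →ₗ[ℂ] (PBond (F.P K) 0 → Matrix (Fin 2) (Fin 2) ℂ) :=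
  Hf F n K h c₀ cB a (DeltaOne F n K h c₀ cB a TJ) U₀

variable [Fact (0 < (F.L : ℝ))] [Fact (0 < ((F.L : ℝ)⁻¹) ^ (K - n))]

/-- **THE EX LETTER `H₁f L i U₀` FOR PRINT'S `H₁` PROPER**: brick L0d's (115)-valued reader `H1f` at `Δx := DeltaOne TJ`. [cite: Balaban1985Variational, (103) p.293, (115)–(117) pp.294–295; Balaban1985BackgroundPropagators, (3.129) p.421] -/
abbrev H1fOne (U₀ : GaugeField (F.P K) 0 (Matrix.specialUnitaryGroup (Fin 2) ℂ)) :
    (PBond (F.P n) 0 → Matrix (Fin 2) (Fin 2) ℂ) →L[ℂ]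
      Space115 (F.L : ℝ) (((F.L : ℝ)⁻¹) ^ (K - n)) (fun _ : Bond 3 (periodsT3 F K) => K - n) (fun _ : Bond 3 (periodsT3 F K) × Fin 3 => K - n)
        (nabla115 (((F.L : ℝ)⁻¹) ^ (K - n)) (bgOfCfg F K U₀)) :=
  H1f F n K h c₀ cB a (DeltaOne F n K h c₀ cB a TJ) U₀

/-- **THE EX LETTER `𝒢f L i U₀` FOR PRINT'S `𝔊 = G₁𝔓*` PROPER**: brick L0d's reader of record `frakGfR` at `Δx := DeltaOne TJ`. [cite: Balaban1985Variational, (111) p.294, (115)–(117) pp.294–295; Balaban1985BackgroundPropagators, (3.147) p.425] -/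
abbrev frakGfOne (U₀ : GaugeField (F.P K) 0 (Matrix.specialUnitaryGroup (Fin 2) ℂ)) :
    NegSize (F.L : ℝ) (((F.L : ℝ)⁻¹) ^ (K - n)) (fun _ : Bond 3 (periodsT3 F K) => K - n) 3 (Matrix (Fin 2) (Fin 2) ℂ) →L[ℂ]
      Space115 (F.L : ℝ) (((F.L : ℝ)⁻¹) ^ (K - n)) (fun _ : Bond 3 (periodsT3 F K) => K - n) (fun _ : Bond 3 (periodsT3 F K) × Fin 3 => K - n)
        (nabla115 (((F.L : ℝ)⁻¹) ^ (K - n)) (bgOfCfg F K U₀)) :=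
  frakGfR F n K h c₀ cB a (DeltaOne F n K h c₀ cB a TJ) U₀

/-! ## §3 Glue -/

variable {F n K h c₀ cB a}

omit [Fact (0 < (F.L : ℝ))] [Fact (0 < ((F.L : ℝ)⁻¹) ^ (K - n))] in
/-- Unfolding `Δ₁ = Pᵀ(Δ^η + T_J)P`. [cite: Balaban1985BackgroundPropagators, (3.128) p.421] -/
theorem DeltaOne_apply (U₀ : GaugeField (F.P K) 0 (Matrix.specialUnitaryGroup (Fin 2) ℂ)) (A : BondL2K ℂ 3 (periodsT3 F K) c₀ W₂) :
    DeltaOne F n K h c₀ cB a TJ U₀ A =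
      LinearMap.adjoint (gaugeCorr F n K h c₀ cB a U₀) (DeltaEta F n K c₀ U₀ (gaugeCorr F n K h c₀ cB a U₀ A) + TJ U₀ (gaugeCorr F n K h c₀ cB a U₀ A)) := rfl

omit [Fact (0 < (F.L : ℝ))] [Fact (0 < ((F.L : ℝ)⁻¹) ^ (K - n))] in
/-- **(3.128) AS A FORM: `⟪A′, Δ₁A⟫ = ⟪PA′, Δ^η(PA)⟫ + ⟪PA′, T_J(PA)⟫`.** [cite: Balaban1985BackgroundPropagators, (3.127)–(3.128) p.421] -/
theorem inner_DeltaOne (U₀ : GaugeField (F.P K) 0 (Matrix.specialUnitaryGroup (Fin 2) ℂ)) (A' A : BondL2K ℂ 3 (periodsT3 F K) c₀ W₂) :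
    ⟪A', DeltaOne F n K h c₀ cB a TJ U₀ A⟫_ℂ =
      ⟪gaugeCorr F n K h c₀ cB a U₀ A', DeltaEta F n K c₀ U₀ (gaugeCorr F n K h c₀ cB a U₀ A)⟫_ℂ + ⟪gaugeCorr F n K h c₀ cB a U₀ A', TJ U₀ (gaugeCorr F n K h c₀ cB a U₀ A)⟫_ℂ := by
  rw [DeltaOne_apply, LinearMap.adjoint_inner_right, inner_add_right]

omit [Fact (0 < (F.L : ℝ))] [Fact (0 < ((F.L : ℝ)⁻¹) ^ (K - n))] in
/-- **`T_J := 0` GIVES BACK `Δ_π`** (print's `G₀ = G` vs `G₁`, p.421: the distinction IS the slot) — hence `G1pi … 0 = Gpi`, `H1pi … 0 = Hpi`, `frakG1pi … 0 = frakGT … DeltaPiSlot` definitionally after this rewrite.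
[cite: Balaban1985BackgroundPropagators, (3.130) p.421] -/
theorem DeltaOne_zero : DeltaOne F n K h c₀ cB a (fun _ => 0) = DeltaPiSlot F n K h c₀ cB a := by
  funext U₀
  rw [DeltaOne, add_zero]
  rfl

end Summit.QuantumFields.YangMills.Theorems.Prop7SectET3DeltaOne

end
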